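import Literature.MathematicalPhysics.KineticTheory.HierarchyTimeSeparation
import HarnessLib

/-!
# Time separation through the blocks of the pruned expansion (BGSR Proposition 5.5, abstract form)
(Bodineau–Gallagher–Saint-Raymond, Invent. Math. 203 (2016) = arXiv:1305.3397v2, §5.3.2
Proposition 5.5; trunk T-KINETIC, topic MathematicalPhysics/KineticTheory; layer N5d₃ of the
bottom-up proof plan of the named fact `bgsr_theorem22` / fact (c)
`bodineau_gallagher_saintRaymond_linear` recorded in `TaggedSphereLinearBoltzmann`, on top of the
term-level time separation `HierarchyTimeSeparation` (N5d₂) and the pruning estimates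
`HierarchyPruningEstimates` (N4b).)

`HierarchyTimeSeparation` imposes BGSR's separation `𝒯_{J,δ}(h)` of the collision times (§5.2.2)
inside one Duhamel term (`HierarchyModel.sepTerm`) and proves the error bound for one term
(`abs_duhamelTerm_sub_sepTerm_le`: `2δ n Λⁿ K t^{n-1}/(n-1)!`, the printed "`δ t^{J-2}/(J-2)!`
instead of `t^{J-1}/(J-1)!`, `J - 1` choices"). This file carries the separation through the
`K` blocks of the pruned expansion (4.10)/(4.12) — the separated main term
`f^{(1,K)}_{δ} = (sepBlockComp K [G])^{(1)}` is the block composite of N4a with every block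
`∑_{j<n_b} Q_{·,·+j}(h)` replaced by its separated version `∑_{j<n_b} Q^δ_{·,·+j}(h)`
(`HierarchyModel.sepBlockOp`, `HierarchyModel.sepBlockComp`) — and PROVES the abstract form of
Proposition 5.5: for a nice family `G` with `|G^{(k)}| ≤ R C₀^k e^{-w H_k}` at the levels
`k ≤ L_K`,
`|(blockComp K [G])^{(1)}(Z) - (sepBlockComp K [G])^{(1)}(Z)| ≤ R C₀ (∏_{b<K} E_b) ∑_{b<K} D_b`
(`HierarchyModel.abs_blockComp_sub_sepBlockComp_le`), where `E_b = ∑_{j<n_b} (C₀ Λ_b h)^j/j!` is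
the block factor of N4b and `D_b = ∑_{j<n_b} 2δ j (C₀ Λ_b)^j h^{j-1}/(j-1)!` the separation error
of block `b` (telescoping over the block in which the separation fails: additivity of the
separated blocks on the Lanford class, `isLevelBdd_sub_sepBlockOp`, and the block estimates of
N4b for plain and separated blocks). Printed: `A^{(K+2)(K+1)} (C α t)^{A^{K+1}} (δ/t) ‖ρ⁰‖_∞`
for both hierarchies; with the budgets `(β/4) 2^{-(K-b)}` of Proposition 4.3 and
`D_b ≤ 2δ C₀ Λ_b n_b e^{C₀ Λ_b h}` (`sepError_le`) this becomes
`12 R C₀ (C₀ c_R δ) A^{2K} exp(12 C₀ c_R h A^K)`, linear in `δ`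
(`HierarchyModel.abs_blockComp_sub_sepBlockComp_le_of_budget`, `c_R = pruneConst M β ∝ α`).

## Main definitions and results

* `HierarchyModel.sepBlockOp`, `HierarchyModel.sepBlockComp` — separated blocks and their
  composites; additivity on the Lanford class (`sepTerm_add`, `sepBlockOp_add`,
  `sepBlockComp_add/sub`).
* `HierarchyModel.isLevelBdd_sepBlockOp`, `HierarchyModel.isLevelBdd_sub_sepBlockOp`,
  `HierarchyModel.abs_sepBlockComp_le` — level bounds through separated blocks and the error of
  one block.
* `HierarchyModel.abs_blockComp_sub_sepBlockComp_le` (product form, any budgets) and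
  `HierarchyModel.abs_blockComp_sub_sepBlockComp_le_of_budget` (printed form).

## References

* T. Bodineau, I. Gallagher, L. Saint-Raymond, *The Brownian motion as the limit of a
  deterministic system of hard-spheres*, Invent. Math. 203 (2016) 493–553 = arXiv:1305.3397v2,
  §5.2.2 (p. 18), §5.3.2 Proposition 5.5 (pp. 19–20 of the held text).
-/

open MeasureTheory Metric Real Set Filter Function
open scoped Nat
open Literature.Analysis.FluidPDE (Config configEnergy GCState duhamelTerm)

namespace Literature.MathematicalPhysics.KineticTheory

noncomputable section

section Kinetic

variable {d : Type*} [Fintype d] {X : Type*} [MeasurableSpace X]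

namespace HierarchyModel

variable (M : HierarchyModel d X)

/-! ## Additivity of the separated terms on the Lanford class -/

/-- Additivity of one separated Duhamel step on nice time-dependent densities. [folklore] -/
theorem sepStep_add {s : ℕ} {T : ℝ} {u₁ u₂ : ℝ → Config (s + 1) d X → ℝ} (h₁ : IsNiceT T u₁)
    (h₂ : IsNiceT T u₂) {δ : ℝ} (hδ : 0 ≤ δ) {t : ℝ} (ht : t ∈ Icc 0 T) (Z : Config s d X) :
    ∫ τ in δ..max δ (t - δ), M.transport s (t - τ) (M.op s (u₁ τ + u₂ τ)) Z =
      (∫ τ in δ..max δ (t - δ), M.transport s (t - τ) (M.op s (u₁ τ)) Z) +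
        ∫ τ in δ..max δ (t - δ), M.transport s (t - τ) (M.op s (u₂ τ)) Z := by
  rcases lt_or_ge t (2 * δ) with hlt | hge
  · rw [max_eq_left (by linarith)]
    simp
  · have hm1 : δ ≤ t - δ := by linarith
    have hm2 : t - δ ≤ t := by linarith
    rw [max_eq_right hm1]
    have hsub : uIcc δ (t - δ) ⊆ uIcc 0 t := by
      rw [uIcc_of_le hm1, uIcc_of_le ht.1]
      exact Icc_subset_Icc hδ hm2
    have hI₁ := (intervalIntegrable_duhamelStep M h₁ ht Z).mono_set hsub
    have hI₂ := (intervalIntegrable_duhamelStep M h₂ ht Z).mono_set hsub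
    rw [← intervalIntegral.integral_add hI₁ hI₂]
    refine intervalIntegral.integral_congr fun τ hτ => ?_
    rw [uIcc_of_le hm1] at hτ
    have hτT : τ ∈ Icc 0 T := ⟨hδ.trans hτ.1, (hτ.2.trans hm2).trans ht.2⟩
    simp only [M.transport_apply]
    rw [M.op_add s (h₁.isNice hτT) (h₂.isNice hτT), Pi.add_apply]

/-- **Additivity of the separated terms** in the family, on nice families, for `t ≥ 0`. [folklore] -/
theorem sepTerm_add {δ : ℝ} (hδ : 0 ≤ δ) {G₁ G₂ : GCState d X} (h₁ : ∀ k, IsNice (G₁ k))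
    (h₂ : ∀ k, IsNice (G₂ k)) (n : ℕ) :
    ∀ (s : ℕ) (t : ℝ), 0 ≤ t → ∀ Z : Config s d X,
      M.sepTerm δ n s t (G₁ + G₂) Z = M.sepTerm δ n s t G₁ Z + M.sepTerm δ n s t G₂ Z := by
  induction n with
  | zero => intro s t _ Z; simp [sepTerm_zero]
  | succ n ih =>
    intro s t ht Z
    rw [sepTerm_succ, sepTerm_succ, sepTerm_succ]
    have hu₁ := M.isNiceT_sepTerm hδ h₁ (T := t) n (s + 1)
    have hu₂ := M.isNiceT_sepTerm hδ h₂ (T := t) n (s + 1)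
    rw [← M.sepStep_add hu₁ hu₂ hδ ⟨ht, le_rfl⟩ Z]
    refine intervalIntegral.integral_congr fun τ hτ => ?_
    rw [uIcc_of_le (le_max_left δ (t - δ))] at hτ
    have hτ0 : 0 ≤ τ := hδ.trans hτ.1
    have hfun : M.sepTerm δ n (s + 1) τ (G₁ + G₂) =
        M.sepTerm δ n (s + 1) τ G₁ + M.sepTerm δ n (s + 1) τ G₂ :=
      funext fun Z' => by rw [Pi.add_apply]; exact ih (s + 1) τ hτ0 Z'
    simp only [hfun]

/-! ## Separated blocks -/

/-- One separated block: `G ↦ (∑_{j<n} Q^δ_{s,s+j}(h) G)_s` (the block of N4a with every Duhamel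
term replaced by its `δ`-separated version). [cite: BodineauGallagherSaintRaymondInvent2016, §5.3.2, p. 19] -/
def sepBlockOp (δ : ℝ) (n : ℕ) (h : ℝ) (G : GCState d X) : GCState d X :=
  fun s Z => ∑ j ∈ Finset.range n, M.sepTerm δ j s h G Z

/-- The first `k` separated blocks composed, outermost first (as `blockComp`). [cite: BodineauGallagherSaintRaymondInvent2016, §5.3.2, p. 19] -/
def sepBlockComp (δ : ℝ) (nseq : ℕ → ℕ) (h : ℝ) : ℕ → GCState d X → GCState d X
  | 0 => id
  | k + 1 => fun G => sepBlockComp δ nseq h k (M.sepBlockOp δ (nseq k) h G)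

/-- Unfolding lemma for one separated block. [folklore] -/
theorem sepBlockOp_apply (δ : ℝ) (n : ℕ) (h : ℝ) (G : GCState d X) (s : ℕ) (Z : Config s d X) :
    M.sepBlockOp δ n h G s Z = ∑ j ∈ Finset.range n, M.sepTerm δ j s h G Z := rfl

/-- Zero separated blocks compose to the identity. [folklore] -/
@[simp]
theorem sepBlockComp_zero (δ : ℝ) (nseq : ℕ → ℕ) (h : ℝ) (G : GCState d X) :
    M.sepBlockComp δ nseq h 0 G = G := rfl

/-- The recursion of the separated block composites (innermost block added last). [folklore] -/
theorem sepBlockComp_succ (δ : ℝ) (nseq : ℕ → ℕ) (h : ℝ) (k : ℕ) (G : GCState d X) :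
    M.sepBlockComp δ nseq h (k + 1) G = M.sepBlockComp δ nseq h k (M.sepBlockOp δ (nseq k) h G) := rfl

variable {M}

/-- Separated blocks preserve nice families (`h ≥ 0`, `δ ≥ 0`). [folklore] -/
theorem isNice_sepBlockOp {δ : ℝ} (hδ : 0 ≤ δ) {G : GCState d X} (hG : ∀ k, IsNice (G k)) (n : ℕ)
    {h : ℝ} (hh : 0 ≤ h) (s : ℕ) : IsNice (M.sepBlockOp δ n h G s) := by
  have := IsNice.sum (Finset.range n) (g := fun j => M.sepTerm δ j s h G)
    fun j _ => (M.isNiceT_sepTerm hδ hG (T := h) j s).isNice ⟨hh, le_rfl⟩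
  convert this using 1
  funext Z
  simp [sepBlockOp_apply, Finset.sum_apply]

/-- Separated blocks are additive on nice families. [folklore] -/
theorem sepBlockOp_add {δ : ℝ} (hδ : 0 ≤ δ) {G₁ G₂ : GCState d X} (h₁ : ∀ k, IsNice (G₁ k))
    (h₂ : ∀ k, IsNice (G₂ k)) (n : ℕ) {h : ℝ} (hh : 0 ≤ h) :
    M.sepBlockOp δ n h (G₁ + G₂) = M.sepBlockOp δ n h G₁ + M.sepBlockOp δ n h G₂ := by
  funext s Z
  simp only [sepBlockOp_apply, Pi.add_apply, ← Finset.sum_add_distrib]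
  exact Finset.sum_congr rfl fun j _ => M.sepTerm_add hδ h₁ h₂ j s h hh Z

/-- Composites of separated blocks preserve nice families. [folklore] -/
theorem isNice_sepBlockComp {δ : ℝ} (hδ : 0 ≤ δ) (nseq : ℕ → ℕ) {h : ℝ} (hh : 0 ≤ h) (k : ℕ) :
    ∀ {G : GCState d X}, (∀ a, IsNice (G a)) → ∀ a, IsNice (M.sepBlockComp δ nseq h k G a) := by
  induction k with
  | zero => intro G hG a; simpa using hG a
  | succ k ih => intro G hG a; exact ih (fun a => isNice_sepBlockOp hδ hG (nseq k) hh a) a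

/-- Composites of separated blocks are additive on nice families. [folklore] -/
theorem sepBlockComp_add {δ : ℝ} (hδ : 0 ≤ δ) (nseq : ℕ → ℕ) {h : ℝ} (hh : 0 ≤ h) (k : ℕ) :
    ∀ {G₁ G₂ : GCState d X}, (∀ a, IsNice (G₁ a)) → (∀ a, IsNice (G₂ a)) →
      M.sepBlockComp δ nseq h k (G₁ + G₂) = M.sepBlockComp δ nseq h k G₁ + M.sepBlockComp δ nseq h k G₂ := by
  induction k with
  | zero => intro G₁ G₂ _ _; rfl
  | succ k ih =>
    intro G₁ G₂ h₁ h₂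
    simp only [sepBlockComp_succ]
    rw [sepBlockOp_add hδ h₁ h₂ (nseq k) hh]
    exact ih (fun a => isNice_sepBlockOp hδ h₁ (nseq k) hh a) (fun a => isNice_sepBlockOp hδ h₂ (nseq k) hh a)

/-- Composites of separated blocks are subtractive on nice families. [folklore] -/
theorem sepBlockComp_sub {δ : ℝ} (hδ : 0 ≤ δ) (nseq : ℕ → ℕ) {h : ℝ} (hh : 0 ≤ h) (k : ℕ)
    {G₁ G₂ : GCState d X} (h₁ : ∀ a, IsNice (G₁ a)) (h₂ : ∀ a, IsNice (G₂ a)) :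
    M.sepBlockComp δ nseq h k (G₁ - G₂) = M.sepBlockComp δ nseq h k G₁ - M.sepBlockComp δ nseq h k G₂ := by
  have hneg : ∀ a, IsNice ((-G₂) a) := fun a => (h₂ a).neg
  have hsub : ∀ a, IsNice ((G₁ - G₂) a) := fun a => by
    simpa [sub_eq_add_neg] using (h₁ a).add (hneg a)
  have h := sepBlockComp_add (M := M) hδ nseq hh k hsub h₂
  rw [sub_add_cancel] at h
  exact eq_sub_of_add_eq h.symm

/-! ## Level bounds through one separated block, and the separation error of one block -/

/-- **One separated block propagates level bounds** exactly as a plain block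
(`isLevelBdd_blockOp` of N4b, with `abs_sepTerm_le_weighted'`). [cite: BodineauGallagherSaintRaymondInvent2016, §5.3.2 Prop. 5.5, pp. 19–20] -/
theorem isLevelBdd_sepBlockOp {δ : ℝ} (hδ : 0 ≤ δ) {G : GCState d X} {Ltop Llow n : ℕ}
    {R C₀ w βb bm : ℝ} (hR : 0 ≤ R) (hC₀ : 1 ≤ C₀) (hbm : 0 < bm) (hβb : 0 < βb) (hw : bm + βb ≤ w)
    (hn : 1 ≤ n) (hL : Llow + n ≤ Ltop + 1) (hG : IsLevelBdd G Ltop R C₀ w) {h : ℝ} (hh : 0 ≤ h) :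
    IsLevelBdd (M.sepBlockOp δ n h G) Llow
      (R * ∑ j ∈ Finset.range n, (C₀ * M.chainCost bm (βb / n) Ltop * h) ^ j / j !) C₀ (w - βb) := by
  intro a ha Z
  set Λ := M.chainCost bm (βb / n) Ltop with hΛ
  have hC₀0 : 0 ≤ C₀ := zero_le_one.trans hC₀
  have hn0 : (0 : ℝ) < n := by exact_mod_cast hn
  have hδw : 0 < βb / n := div_pos hβb hn0
  have hb₀ : bm ≤ w - βb := by linarith
  rw [M.sepBlockOp_apply]
  refine (Finset.abs_sum_le_sum_abs _ _).trans ?_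
  rw [Finset.mul_sum, Finset.sum_mul, Finset.sum_mul]
  refine Finset.sum_le_sum fun j hj => ?_
  have hjn : j < n := Finset.mem_range.1 hj
  have haj : a + j ≤ Ltop + 1 := by omega
  have hK : 0 ≤ R * C₀ ^ (a + j) := by positivity
  have hin : ∀ Z' : Config (a + j) d X, |G (a + j) Z'| ≤
      R * C₀ ^ (a + j) * exp (-((w - βb) + j * (βb / n)) * configEnergy Z') := by
    intro Z'
    refine (hG (a + j) (by omega) Z').trans ?_
    have hE : 0 ≤ configEnergy Z' := configEnergy_nonneg' Z'
    have hwle : (w - βb) + j * (βb / n) ≤ w := by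
      have hj' : (j : ℝ) ≤ n := by exact_mod_cast hjn.le
      have : (j : ℝ) * (βb / n) ≤ βb := by
        rw [mul_div_assoc', div_le_iff₀ hn0]
        nlinarith
      linarith
    gcongr R * C₀ ^ (a + j) * ?_
    exact exp_le_exp.2 (by nlinarith)
  have hest := M.abs_sepTerm_le_weighted' hδ hbm hδw Ltop j a haj hb₀ hK G hin hh Z
  refine hest.trans (le_of_eq ?_)
  change R * C₀ ^ (a + j) * Λ ^ j * h ^ j / j ! * exp (-(w - βb) * configEnergy Z) = _
  rw [pow_add, mul_pow, mul_pow]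
  ring

/-- **The separation error of one block**: the difference of a plain and a separated block is
level-bounded with the constant `R ∑_{j<n} 2δ j (C₀Λ)^j h^{j-1}/(j-1)!` (term by term,
`abs_duhamelTerm_sub_sepTerm_le'`). [cite: BodineauGallagherSaintRaymondInvent2016, §5.3.2 Prop. 5.5, pp. 19–20] -/
theorem isLevelBdd_sub_sepBlockOp {δ : ℝ} (hδ : 0 ≤ δ) {G : GCState d X} (hGn : ∀ k, IsNice (G k))
    {Ltop Llow n : ℕ} {R C₀ w βb bm : ℝ} (hR : 0 ≤ R) (hC₀ : 1 ≤ C₀) (hbm : 0 < bm) (hβb : 0 < βb)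
    (hw : bm + βb ≤ w) (hn : 1 ≤ n) (hL : Llow + n ≤ Ltop + 1) (hG : IsLevelBdd G Ltop R C₀ w)
    {h : ℝ} (hh : 0 ≤ h) :
    IsLevelBdd (M.blockOp n h G - M.sepBlockOp δ n h G) Llow
      (R * ∑ j ∈ Finset.range n,
        2 * δ * j * ((C₀ * M.chainCost bm (βb / n) Ltop) ^ j * h ^ (j - 1) / (j - 1)!)) C₀ (w - βb) := by
  intro a ha Z
  set Λ := M.chainCost bm (βb / n) Ltop with hΛ
  have hC₀0 : 0 ≤ C₀ := zero_le_one.trans hC₀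
  have hn0 : (0 : ℝ) < n := by exact_mod_cast hn
  have hδw : 0 < βb / n := div_pos hβb hn0
  have hb₀ : bm ≤ w - βb := by linarith
  rw [Pi.sub_apply, Pi.sub_apply, M.blockOp_apply, M.sepBlockOp_apply, ← Finset.sum_sub_distrib]
  refine (Finset.abs_sum_le_sum_abs _ _).trans ?_
  rw [Finset.mul_sum, Finset.sum_mul, Finset.sum_mul]
  refine Finset.sum_le_sum fun j hj => ?_
  have hjn : j < n := Finset.mem_range.1 hj
  have haj : a + j ≤ Ltop + 1 := by omega
  have hK : 0 ≤ R * C₀ ^ (a + j) := by positivity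
  have hin : ∀ Z' : Config (a + j) d X, |G (a + j) Z'| ≤
      R * C₀ ^ (a + j) * exp (-((w - βb) + j * (βb / n)) * configEnergy Z') := by
    intro Z'
    refine (hG (a + j) (by omega) Z').trans ?_
    have hE : 0 ≤ configEnergy Z' := configEnergy_nonneg' Z'
    have hwle : (w - βb) + j * (βb / n) ≤ w := by
      have hj' : (j : ℝ) ≤ n := by exact_mod_cast hjn.le
      have : (j : ℝ) * (βb / n) ≤ βb := by
        rw [mul_div_assoc', div_le_iff₀ hn0]
        nlinarith
      linarith
    gcongr R * C₀ ^ (a + j) * ?_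
    exact exp_le_exp.2 (by nlinarith)
  have hest := M.abs_duhamelTerm_sub_sepTerm_le' hδ hbm hδw Ltop j a haj hb₀ hK hGn hin hh Z
  refine hest.trans (le_of_eq ?_)
  change 2 * δ * j * (R * C₀ ^ (a + j) * Λ ^ j * h ^ (j - 1) / (j - 1)!) *
      exp (-(w - βb) * configEnergy Z) = _
  rw [pow_add, mul_pow]
  ring

/-! ## The block estimates -/

/-- The block factor `E = ∑_{j<n} xʲ/j!` is at least `1` (`n ≥ 1`, `x ≥ 0`). [folklore] -/
theorem one_le_blockFactor {x : ℝ} (hx : 0 ≤ x) {n : ℕ} (hn : 1 ≤ n) :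
    1 ≤ ∑ j ∈ Finset.range n, x ^ j / j ! := by
  have h0 : 0 ∈ Finset.range n := Finset.mem_range.2 (by omega)
  have := Finset.single_le_sum (f := fun j => x ^ j / j !) (fun j _ => by positivity) h0
  simpa using this

/-- **Composition of separated blocks** (the separated analogue of N4b's `abs_blockComp_le`, same
majorant). [cite: BodineauGallagherSaintRaymondInvent2016, §5.3.2 Prop. 5.5, pp. 19–20] -/
theorem abs_sepBlockComp_le {δ : ℝ} (hδ : 0 ≤ δ) {A : ℕ} (hA : 1 ≤ A) {bm C₀ : ℝ} (hbm : 0 < bm)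
    (hC₀ : 1 ≤ C₀) (βs : ℕ → ℝ) (hβs : ∀ b, 0 < βs b) {h : ℝ} (hh : 0 ≤ h) :
    ∀ (i : ℕ) (G : GCState d X) (R w : ℝ), 0 ≤ R → bm + ∑ b ∈ Finset.range i, βs b ≤ w →
      IsLevelBdd G (pruneLevel A i) R C₀ w →
      ∀ Z : Config 1 d X, |M.sepBlockComp δ (pruneSeq A) h i G 1 Z| ≤
        R * C₀ * ∏ b ∈ Finset.range i, ∑ j ∈ Finset.range (pruneSeq A b),
          (C₀ * M.chainCost bm (βs b / pruneSeq A b) (pruneLevel A (b + 1)) * h) ^ j / j ! := by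
  have hC₀0 : 0 ≤ C₀ := zero_le_one.trans hC₀
  intro i
  induction i with
  | zero =>
    intro G R w hR hw hG Z
    simp only [sepBlockComp_zero, Finset.range_zero, Finset.prod_empty, mul_one]
    have hw0 : 0 ≤ w := by
      simp only [Finset.range_zero, Finset.sum_empty, add_zero] at hw
      linarith
    have hE := configEnergy_nonneg' Z
    calc |G 1 Z| ≤ R * C₀ ^ 1 * exp (-w * configEnergy Z) := hG 1 (by simp) Z
      _ ≤ R * C₀ ^ 1 * 1 := by
          have : 0 ≤ R * C₀ ^ 1 := by positivity
          gcongr R * C₀ ^ 1 * ?_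
          exact exp_le_one_iff.2 (by nlinarith)
      _ = R * C₀ := by ring
  | succ i ih =>
    intro G R w hR hw hG Z
    rw [sepBlockComp_succ]
    have hsum0 : 0 ≤ ∑ b ∈ Finset.range i, βs b := Finset.sum_nonneg fun b _ => (hβs b).le
    rw [Finset.sum_range_succ] at hw
    have hL : pruneLevel A i + pruneSeq A i ≤ pruneLevel A (i + 1) + 1 := (pruneLevel_succ hA i).symm.le
    have hwb : bm + βs i ≤ w := by linarith
    have hG' := isLevelBdd_sepBlockOp (M := M) hδ hR hC₀ hbm (hβs i) hwb (one_le_pruneSeq hA i) hL hG hh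
    have hR' : 0 ≤ R * ∑ j ∈ Finset.range (pruneSeq A i),
        (C₀ * M.chainCost bm (βs i / pruneSeq A i) (pruneLevel A (i + 1)) * h) ^ j / j ! := by
      refine mul_nonneg hR (Finset.sum_nonneg fun j _ => ?_)
      have := M.chainCost_nonneg bm (βs i / pruneSeq A i) (pruneLevel A (i + 1))
      positivity
    have hw' : bm + ∑ b ∈ Finset.range i, βs b ≤ w - βs i := by linarith
    refine (ih _ _ _ hR' hw' hG' Z).trans (le_of_eq ?_)
    rw [Finset.prod_range_succ]
    ring

/-- The real arithmetic of the induction step of `abs_blockComp_sub_sepBlockComp_le`: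
`E ≥ 1` absorbs the error of the innermost block into the product. [folklore] -/
theorem sepInduction_aux {x₁ x₂ R C₀ E D P S : ℝ} (hR : 0 ≤ R) (hC₀ : 0 ≤ C₀) (hE : 1 ≤ E)
    (hD : 0 ≤ D) (hP : 0 ≤ P) (h₁ : x₁ ≤ R * E * C₀ * P * S) (h₂ : x₂ ≤ R * D * C₀ * P) :
    x₁ + x₂ ≤ R * C₀ * (P * E) * (S + D) := by
  have h3 : R * D * C₀ * P ≤ R * (E * D) * C₀ * P := by
    have : D ≤ E * D := le_mul_of_one_le_left hD hE
    have h0 : 0 ≤ R := hR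
    gcongr
  nlinarith [h3]

/-- **BGSR Proposition 5.5 through the blocks, abstract form.** For thresholds `n_{b+1} = A^(b+1)`,
a weight floor `λₘ`, budgets `β_b > 0` with `λₘ + ∑_{b<i} β_b ≤ w`, a step `h ≥ 0`, a separation
`δ ≥ 0` and a NICE family `G` with `|G^{(a)}| ≤ R C₀^a e^{-w H}` at all levels `a ≤ L_i`:
`|(blockComp i G)^{(1)}(Z) - (sepBlockComp i G)^{(1)}(Z)| ≤ R C₀ (∏_{b<i} E_b) (∑_{b<i} D_b)`,
`E_b = ∑_{j<n_{b+1}} (C₀ Λ_b h)^j/j!`, `D_b = ∑_{j<n_{b+1}} 2δ j (C₀ Λ_b)^j h^{j-1}/(j-1)!`,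
`Λ_b = chainCost λₘ (β_b/n_{b+1}) L_{b+1}`. Induction on `i`: the difference for `i + 1` blocks is
the difference of the `i` outer blocks applied to the plain inner block (induction hypothesis with
`isLevelBdd_blockOp`) plus the `i` outer separated blocks applied to the difference of the inner
blocks (`sepBlockComp_sub` on the Lanford class, `abs_sepBlockComp_le` with
`isLevelBdd_sub_sepBlockOp`); `E_i ≥ 1` absorbs the second term into the product.
[cite: BodineauGallagherSaintRaymondInvent2016, §5.3.2 Prop. 5.5, pp. 19–20] -/
theorem abs_blockComp_sub_sepBlockComp_le {δ : ℝ} (hδ : 0 ≤ δ) {A : ℕ} (hA : 1 ≤ A) {bm C₀ : ℝ}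
    (hbm : 0 < bm) (hC₀ : 1 ≤ C₀) (βs : ℕ → ℝ) (hβs : ∀ b, 0 < βs b) {h : ℝ} (hh : 0 ≤ h) :
    ∀ (i : ℕ) (G : GCState d X) (R w : ℝ), 0 ≤ R → (∀ k, IsNice (G k)) →
      bm + ∑ b ∈ Finset.range i, βs b ≤ w → IsLevelBdd G (pruneLevel A i) R C₀ w →
      ∀ Z : Config 1 d X,
        |M.blockComp (pruneSeq A) h i G 1 Z - M.sepBlockComp δ (pruneSeq A) h i G 1 Z| ≤
          R * C₀ *
            (∏ b ∈ Finset.range i, ∑ j ∈ Finset.range (pruneSeq A b),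
              (C₀ * M.chainCost bm (βs b / pruneSeq A b) (pruneLevel A (b + 1)) * h) ^ j / j !) *
            ∑ b ∈ Finset.range i, ∑ j ∈ Finset.range (pruneSeq A b),
              2 * δ * j * ((C₀ * M.chainCost bm (βs b / pruneSeq A b) (pruneLevel A (b + 1))) ^ j *
                h ^ (j - 1) / (j - 1)!) := by
  have hC₀0 : 0 ≤ C₀ := zero_le_one.trans hC₀
  intro i
  induction i with
  | zero =>
    intro G R w _ _ _ _ Z
    simp
  | succ i ih =>
    intro G R w hR hGn hw hG Z
    have hn1 : 1 ≤ pruneSeq A i := one_le_pruneSeq hA i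
    have hΛ0 : 0 ≤ M.chainCost bm (βs i / pruneSeq A i) (pruneLevel A (i + 1)) := M.chainCost_nonneg _ _ _
    have hE1 : 1 ≤ ∑ j ∈ Finset.range (pruneSeq A i),
        (C₀ * M.chainCost bm (βs i / pruneSeq A i) (pruneLevel A (i + 1)) * h) ^ j / j ! :=
      one_le_blockFactor (by positivity) hn1
    have hE0 := zero_le_one.trans hE1
    have hD0 : 0 ≤ ∑ j ∈ Finset.range (pruneSeq A i), 2 * δ * j *
        ((C₀ * M.chainCost bm (βs i / pruneSeq A i) (pruneLevel A (i + 1))) ^ j * h ^ (j - 1) / (j - 1)!) :=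
      Finset.sum_nonneg fun j _ => by positivity
    have hsum0 : 0 ≤ ∑ b ∈ Finset.range i, βs b := Finset.sum_nonneg fun b _ => (hβs b).le
    rw [Finset.sum_range_succ] at hw
    have hL : pruneLevel A i + pruneSeq A i ≤ pruneLevel A (i + 1) + 1 := (pruneLevel_succ hA i).symm.le
    have hwb : bm + βs i ≤ w := by linarith
    have hw' : bm + ∑ b ∈ Finset.range i, βs b ≤ w - βs i := by linarith
    -- the inner blocks: plain, separated, and their difference
    have hBnice : ∀ a, IsNice (M.blockOp (pruneSeq A i) h G a) := fun a => isNice_blockOp hGn _ hh a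
    have hSnice : ∀ a, IsNice (M.sepBlockOp δ (pruneSeq A i) h G a) :=
      fun a => isNice_sepBlockOp hδ hGn _ hh a
    have hB := M.isLevelBdd_blockOp hR hC₀ hbm (hβs i) hwb hn1 hL hG hh
    have hBS := isLevelBdd_sub_sepBlockOp (M := M) hδ hGn hR hC₀ hbm (hβs i) hwb hn1 hL hG hh
    have h1 := ih (M.blockOp (pruneSeq A i) h G) _ (w - βs i) (mul_nonneg hR hE0) hBnice hw' hB Z
    have h2 := abs_sepBlockComp_le (M := M) hδ hA hbm hC₀ βs hβs hh i
      (M.blockOp (pruneSeq A i) h G - M.sepBlockOp δ (pruneSeq A i) h G) _ (w - βs i)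
      (mul_nonneg hR hD0) hw' hBS Z
    have hP0 : 0 ≤ ∏ b ∈ Finset.range i, ∑ j ∈ Finset.range (pruneSeq A b),
        (C₀ * M.chainCost bm (βs b / pruneSeq A b) (pruneLevel A (b + 1)) * h) ^ j / j ! :=
      Finset.prod_nonneg fun b _ => Finset.sum_nonneg fun j _ => by
        have := M.chainCost_nonneg bm (βs b / pruneSeq A b) (pruneLevel A (b + 1)); positivity
    -- split the difference: `X - Y[S G] = (X - Y[B G]) + Y[B G - S G]`
    have hsplit : M.sepBlockComp δ (pruneSeq A) h i (M.blockOp (pruneSeq A i) h G) 1 Z =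
        M.sepBlockComp δ (pruneSeq A) h i (M.blockOp (pruneSeq A i) h G - M.sepBlockOp δ (pruneSeq A i) h G) 1 Z +
          M.sepBlockComp δ (pruneSeq A) h i (M.sepBlockOp δ (pruneSeq A i) h G) 1 Z := by
      rw [sepBlockComp_sub hδ (pruneSeq A) hh i hBnice hSnice, Pi.sub_apply, Pi.sub_apply, sub_add_cancel]
    rw [blockComp_succ, sepBlockComp_succ, Finset.prod_range_succ, Finset.sum_range_succ]
    have htri : |M.blockComp (pruneSeq A) h i (M.blockOp (pruneSeq A i) h G) 1 Z -
          M.sepBlockComp δ (pruneSeq A) h i (M.sepBlockOp δ (pruneSeq A i) h G) 1 Z| ≤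
        |M.blockComp (pruneSeq A) h i (M.blockOp (pruneSeq A i) h G) 1 Z -
            M.sepBlockComp δ (pruneSeq A) h i (M.blockOp (pruneSeq A i) h G) 1 Z| +
          |M.sepBlockComp δ (pruneSeq A) h i
            (M.blockOp (pruneSeq A i) h G - M.sepBlockOp δ (pruneSeq A i) h G) 1 Z| := by
      refine le_of_eq_of_le ?_ (abs_add_le _ _)
      congr 1
      rw [hsplit]
      ring
    exact htri.trans (sepInduction_aux hR hC₀0 hE1 hD0 hP0 h1 h2)

/-! ## The printed form: budgets `(β/4) 2^{-(K-b)}` and the factor `δ` -/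

/-- The separation error of one block is linear in `δ`: `∑_{j<n} 2δ j xʲ h^{j-1}/(j-1)! ≤
2δ x n e^{x h}` (`x = C₀ Λ`). [folklore] -/
theorem sepError_le {x δ h : ℝ} (hx : 0 ≤ x) (hδ : 0 ≤ δ) (hh : 0 ≤ h) (n : ℕ) :
    ∑ j ∈ Finset.range n, 2 * δ * j * (x ^ j * h ^ (j - 1) / (j - 1)!) ≤ 2 * δ * x * n * exp (x * h) := by
  cases n with
  | zero => simp
  | succ k =>
    rw [Finset.sum_range_succ']
    simp only [Nat.cast_zero, mul_zero, zero_mul, add_zero, Nat.add_sub_cancel]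
    have hxh : 0 ≤ x * h := mul_nonneg hx hh
    have hterm : ∀ j ∈ Finset.range k, 2 * δ * ((j + 1 : ℕ) : ℝ) * (x ^ (j + 1) * h ^ j / j !) ≤
        2 * δ * x * (k + 1 : ℕ) * ((x * h) ^ j / j !) := by
      intro j hj
      have hjk : ((j + 1 : ℕ) : ℝ) ≤ (k + 1 : ℕ) := by
        have := Finset.mem_range.1 hj
        exact_mod_cast (by omega : j + 1 ≤ k + 1)
      have h0 : 0 ≤ (x * h) ^ j / j ! := by positivity
      calc 2 * δ * ((j + 1 : ℕ) : ℝ) * (x ^ (j + 1) * h ^ j / j !)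
          = 2 * δ * x * ((j + 1 : ℕ) : ℝ) * ((x * h) ^ j / j !) := by rw [pow_succ, mul_pow]; ring
        _ ≤ 2 * δ * x * (k + 1 : ℕ) * ((x * h) ^ j / j !) := by gcongr
    calc ∑ j ∈ Finset.range k, 2 * δ * ((j + 1 : ℕ) : ℝ) * (x ^ (j + 1) * h ^ j / j !)
        ≤ ∑ j ∈ Finset.range k, 2 * δ * x * (k + 1 : ℕ) * ((x * h) ^ j / j !) := Finset.sum_le_sum hterm
      _ = 2 * δ * x * (k + 1 : ℕ) * ∑ j ∈ Finset.range k, (x * h) ^ j / j ! := by rw [Finset.mul_sum]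
      _ ≤ 2 * δ * x * (k + 1 : ℕ) * exp (x * h) := by
          gcongr
          exact Real.sum_le_exp_of_nonneg hxh k

/-- The block factor at full weight: with floor `β/2` and budgets `(β/4) 2^{-(K-b)}` the `K`
blocks cost at most `exp(6 C₀ c_R h A^K)`, `c_R = pruneConst M β` (the computation of N4b's
`abs_blockComp_iterRem_le`, part (b)). [folklore] -/
theorem prod_blockFactor_le {A : ℕ} (hA : 2 ≤ A) {C₀ β h : ℝ} (hC₀ : 1 ≤ C₀) (hβ : 0 < β)
    (hh0 : 0 ≤ h) (K : ℕ) :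
    ∏ b ∈ Finset.range K, ∑ j ∈ Finset.range (pruneSeq A b),
        (C₀ * M.chainCost (β / 2) (β / 4 / 2 ^ (K - b) / pruneSeq A b) (pruneLevel A (b + 1)) * h) ^ j / j ! ≤
      exp (6 * (C₀ * M.pruneConst β * h) * (A : ℝ) ^ K) := by
  have hA1 : 1 ≤ A := by omega
  have hC₀0 : 0 ≤ C₀ := zero_le_one.trans hC₀
  set x := C₀ * M.pruneConst β * h with hx
  have hx0 : 0 ≤ x := by
    have := M.pruneConst_nonneg β
    positivity
  have hblock_le : ∀ b ∈ Finset.range K, ∑ j ∈ Finset.range (pruneSeq A b),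
      (C₀ * M.chainCost (β / 2) (β / 4 / 2 ^ (K - b) / pruneSeq A b) (pruneLevel A (b + 1)) * h) ^ j / j ! ≤
        exp (x * ((A : ℝ) ^ (b + 1) * sqrt 2 ^ (K - b))) := by
    intro b hb
    have hnb : (0 : ℝ) < pruneSeq A b := by exact_mod_cast one_le_pruneSeq hA1 b
    have hq : (1 : ℝ) ≤ sqrt 2 ^ (K - b) := one_le_pow₀ Real.one_lt_sqrt_two.le
    have hΛb : M.chainCost (β / 2) (β / 4 / 2 ^ (K - b) / pruneSeq A b) (pruneLevel A (b + 1)) ≤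
        M.pruneConst β * pruneSeq A b * sqrt 2 ^ (K - b) := by
      refine M.chainCost_le hβ hq hnb (le_of_eq ?_) ?_
      · have hq2 : (sqrt 2 ^ (K - b)) ^ 2 = (2 : ℝ) ^ (K - b) := by
          rw [← pow_mul, mul_comm (K - b) 2, pow_mul, sq_sqrt zero_le_two]
        rw [hq2]
        field_simp
      · have := pruneLevel_succ_le hA b
        have h' : ((pruneLevel A (b + 1) : ℕ) : ℝ) ≤ ((2 * A ^ (b + 1) : ℕ) : ℝ) := by exact_mod_cast this
        simpa [pruneSeq_apply] using h'
    have h0 : 0 ≤ C₀ * M.chainCost (β / 2) (β / 4 / 2 ^ (K - b) / pruneSeq A b) (pruneLevel A (b + 1)) * h := by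
      have := M.chainCost_nonneg (β / 2) (β / 4 / 2 ^ (K - b) / pruneSeq A b) (pruneLevel A (b + 1))
      positivity
    refine (Real.sum_le_exp_of_nonneg h0 _).trans (exp_le_exp.2 ?_)
    calc C₀ * M.chainCost (β / 2) (β / 4 / 2 ^ (K - b) / pruneSeq A b) (pruneLevel A (b + 1)) * h
        ≤ C₀ * (M.pruneConst β * pruneSeq A b * sqrt 2 ^ (K - b)) * h := by gcongr
      _ = x * ((A : ℝ) ^ (b + 1) * sqrt 2 ^ (K - b)) := by
          rw [hx, pruneSeq_apply]; push_cast; ring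
  calc ∏ b ∈ Finset.range K, ∑ j ∈ Finset.range (pruneSeq A b),
        (C₀ * M.chainCost (β / 2) (β / 4 / 2 ^ (K - b) / pruneSeq A b) (pruneLevel A (b + 1)) * h) ^ j / j !
      ≤ ∏ b ∈ Finset.range K, exp (x * ((A : ℝ) ^ (b + 1) * sqrt 2 ^ (K - b))) := by
        refine Finset.prod_le_prod (fun b _ => Finset.sum_nonneg fun j _ => ?_) hblock_le
        have := M.chainCost_nonneg (β / 2) (β / 4 / 2 ^ (K - b) / pruneSeq A b) (pruneLevel A (b + 1))
        positivity
    _ = exp (x * ∑ b ∈ Finset.range K, (A : ℝ) ^ (b + 1) * sqrt 2 ^ (K - b)) := by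
        rw [Finset.mul_sum, Real.exp_sum]
    _ ≤ exp (6 * x * (A : ℝ) ^ K) := by
        refine exp_le_exp.2 ?_
        have hs := sum_pow_mul_sqrt_two_pow_le hA K
        calc x * ∑ b ∈ Finset.range K, (A : ℝ) ^ (b + 1) * sqrt 2 ^ (K - b) ≤ x * (6 * (A : ℝ) ^ K) :=
              mul_le_mul_of_nonneg_left hs hx0
          _ = 6 * x * (A : ℝ) ^ K := by ring

/-- The separation errors of the `K` blocks at full weight add up to at most
`12 δ C₀ c_R A^{2K} exp(6 C₀ c_R h A^K)`. [folklore] -/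
theorem sum_sepError_le {δ : ℝ} (hδ : 0 ≤ δ) {A : ℕ} (hA : 2 ≤ A) {C₀ β h : ℝ} (hC₀ : 1 ≤ C₀)
    (hβ : 0 < β) (hh0 : 0 ≤ h) (K : ℕ) :
    ∑ b ∈ Finset.range K, ∑ j ∈ Finset.range (pruneSeq A b),
        2 * δ * j * ((C₀ * M.chainCost (β / 2) (β / 4 / 2 ^ (K - b) / pruneSeq A b) (pruneLevel A (b + 1))) ^ j *
          h ^ (j - 1) / (j - 1)!) ≤
      12 * δ * (C₀ * M.pruneConst β) * (A : ℝ) ^ (2 * K) * exp (6 * (C₀ * M.pruneConst β * h) * (A : ℝ) ^ K) := by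
  have hA1 : 1 ≤ A := by omega
  have hC₀0 : 0 ≤ C₀ := zero_le_one.trans hC₀
  have hcR := M.pruneConst_nonneg β
  set x := C₀ * M.pruneConst β * h with hx
  have hx0 : 0 ≤ x := by positivity
  -- the geometric bookkeeping: every `n_b √2^{K-b}` is below `6 A^K`, and `∑ n_b² √2^{K-b} ≤ 6 A^{2K}`
  have hsum := sum_pow_mul_sqrt_two_pow_le hA K
  have hsingle : ∀ b ∈ Finset.range K, (A : ℝ) ^ (b + 1) * sqrt 2 ^ (K - b) ≤ 6 * (A : ℝ) ^ K := by
    intro b hb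
    refine le_trans ?_ hsum
    exact Finset.single_le_sum (f := fun b => (A : ℝ) ^ (b + 1) * sqrt 2 ^ (K - b))
      (fun b _ => by positivity) hb
  have hA2 : 2 ≤ A ^ 2 := by nlinarith
  have hsum2 : ∑ b ∈ Finset.range K, ((A : ℝ) ^ (b + 1)) ^ 2 * sqrt 2 ^ (K - b) ≤ 6 * (A : ℝ) ^ (2 * K) := by
    have := sum_pow_mul_sqrt_two_pow_le hA2 K
    push_cast at this
    calc ∑ b ∈ Finset.range K, ((A : ℝ) ^ (b + 1)) ^ 2 * sqrt 2 ^ (K - b)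
        = ∑ b ∈ Finset.range K, ((A : ℝ) ^ 2) ^ (b + 1) * sqrt 2 ^ (K - b) := by
          refine Finset.sum_congr rfl fun b _ => ?_
          rw [← pow_mul, ← pow_mul, mul_comm 2 (b + 1)]
      _ ≤ 6 * ((A : ℝ) ^ 2) ^ K := this
      _ = 6 * (A : ℝ) ^ (2 * K) := by rw [← pow_mul]
  -- each block
  have hblock : ∀ b ∈ Finset.range K, ∑ j ∈ Finset.range (pruneSeq A b),
      2 * δ * j * ((C₀ * M.chainCost (β / 2) (β / 4 / 2 ^ (K - b) / pruneSeq A b) (pruneLevel A (b + 1))) ^ j *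
        h ^ (j - 1) / (j - 1)!) ≤
      2 * δ * (C₀ * M.pruneConst β) * (((A : ℝ) ^ (b + 1)) ^ 2 * sqrt 2 ^ (K - b)) * exp (6 * x * (A : ℝ) ^ K) := by
    intro b hb
    have hnb : (0 : ℝ) < pruneSeq A b := by exact_mod_cast one_le_pruneSeq hA1 b
    have hq : (1 : ℝ) ≤ sqrt 2 ^ (K - b) := one_le_pow₀ Real.one_lt_sqrt_two.le
    set Λ := M.chainCost (β / 2) (β / 4 / 2 ^ (K - b) / pruneSeq A b) (pruneLevel A (b + 1)) with hΛ
    have hΛ0 : 0 ≤ Λ := M.chainCost_nonneg _ _ _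
    have hΛb : Λ ≤ M.pruneConst β * pruneSeq A b * sqrt 2 ^ (K - b) := by
      refine M.chainCost_le hβ hq hnb (le_of_eq ?_) ?_
      · have hq2 : (sqrt 2 ^ (K - b)) ^ 2 = (2 : ℝ) ^ (K - b) := by
          rw [← pow_mul, mul_comm (K - b) 2, pow_mul, sq_sqrt zero_le_two]
        rw [hq2]
        field_simp
      · have := pruneLevel_succ_le hA b
        have h' : ((pruneLevel A (b + 1) : ℕ) : ℝ) ≤ ((2 * A ^ (b + 1) : ℕ) : ℝ) := by exact_mod_cast this
        simpa [pruneSeq_apply] using h'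
    have hnA : ((pruneSeq A b : ℕ) : ℝ) = (A : ℝ) ^ (b + 1) := by rw [pruneSeq_apply]; push_cast; ring
    have h1 := sepError_le (x := C₀ * Λ) (by positivity) hδ hh0 (pruneSeq A b)
    refine h1.trans ?_
    -- `C₀ Λ ≤ (C₀ c_R) n_b √2^{K-b}` and `C₀ Λ h ≤ x n_b √2^{K-b} ≤ 6 x A^K`
    have hCΛ : C₀ * Λ ≤ C₀ * M.pruneConst β * ((A : ℝ) ^ (b + 1) * sqrt 2 ^ (K - b)) := by
      calc C₀ * Λ ≤ C₀ * (M.pruneConst β * pruneSeq A b * sqrt 2 ^ (K - b)) := by gcongr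
        _ = C₀ * M.pruneConst β * ((A : ℝ) ^ (b + 1) * sqrt 2 ^ (K - b)) := by rw [hnA]; ring
    have hexp : exp (C₀ * Λ * h) ≤ exp (6 * x * (A : ℝ) ^ K) := by
      refine exp_le_exp.2 ?_
      calc C₀ * Λ * h ≤ C₀ * M.pruneConst β * ((A : ℝ) ^ (b + 1) * sqrt 2 ^ (K - b)) * h :=
            mul_le_mul_of_nonneg_right hCΛ hh0
        _ = x * ((A : ℝ) ^ (b + 1) * sqrt 2 ^ (K - b)) := by rw [hx]; ring
        _ ≤ x * (6 * (A : ℝ) ^ K) := mul_le_mul_of_nonneg_left (hsingle b hb) hx0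
        _ = 6 * x * (A : ℝ) ^ K := by ring
    have hq1 : (1 : ℝ) ≤ sqrt 2 ^ (K - b) := hq
    calc 2 * δ * (C₀ * Λ) * (pruneSeq A b : ℕ) * exp (C₀ * Λ * h)
        ≤ 2 * δ * (C₀ * M.pruneConst β * ((A : ℝ) ^ (b + 1) * sqrt 2 ^ (K - b))) * (A : ℝ) ^ (b + 1) *
            exp (6 * x * (A : ℝ) ^ K) := by rw [hnA]; gcongr
      _ = 2 * δ * (C₀ * M.pruneConst β) * (((A : ℝ) ^ (b + 1)) ^ 2 * sqrt 2 ^ (K - b)) *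
            exp (6 * x * (A : ℝ) ^ K) := by ring
  calc ∑ b ∈ Finset.range K, ∑ j ∈ Finset.range (pruneSeq A b),
        2 * δ * j * ((C₀ * M.chainCost (β / 2) (β / 4 / 2 ^ (K - b) / pruneSeq A b) (pruneLevel A (b + 1))) ^ j *
          h ^ (j - 1) / (j - 1)!)
      ≤ ∑ b ∈ Finset.range K, 2 * δ * (C₀ * M.pruneConst β) * (((A : ℝ) ^ (b + 1)) ^ 2 * sqrt 2 ^ (K - b)) *
          exp (6 * x * (A : ℝ) ^ K) := Finset.sum_le_sum hblock
    _ = 2 * δ * (C₀ * M.pruneConst β) * exp (6 * x * (A : ℝ) ^ K) *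
          ∑ b ∈ Finset.range K, ((A : ℝ) ^ (b + 1)) ^ 2 * sqrt 2 ^ (K - b) := by
        rw [Finset.mul_sum]
        refine Finset.sum_congr rfl fun b _ => ?_
        ring
    _ ≤ 2 * δ * (C₀ * M.pruneConst β) * exp (6 * x * (A : ℝ) ^ K) * (6 * (A : ℝ) ^ (2 * K)) := by
        have : 0 ≤ 2 * δ * (C₀ * M.pruneConst β) * exp (6 * x * (A : ℝ) ^ K) := by positivity
        exact mul_le_mul_of_nonneg_left hsum2 this
    _ = 12 * δ * (C₀ * M.pruneConst β) * (A : ℝ) ^ (2 * K) * exp (6 * x * (A : ℝ) ^ K) := by ring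

/-- **BGSR Proposition 5.5 through the blocks, with the budgets of Proposition 4.3.** For a nice
family `G` with `|G^{(a)}| ≤ R C₀^a e^{-β H}` at the levels `a ≤ L_K` (`R ≥ 0`, `C₀ ≥ 1`,
`β > 0`), thresholds `n_k = A^k` (`A ≥ 2`), a step `h ≥ 0` and a separation `δ ≥ 0`:
`|(blockComp K [G])^{(1)}(Z) - (sepBlockComp K [G])^{(1)}(Z)| ≤
12 R C₀ (C₀ c_R δ) A^{2K} exp(12 C₀ c_R h A^K)`, `c_R = pruneConst M β` — linear in `δ`
(printed: `A^{(K+2)(K+1)} (C α t)^{A^{K+1}} (δ/t) ‖ρ⁰‖_∞`; here the polynomial `A^{2K}` and the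
block factor `exp(12 C₀ c_R h A^K)` of N4b's step condition take the place of
`A^{(K+2)(K+1)} (Cαt)^{A^{K+1}}/t`, and `c_R ∝ opConst ∝ α`).
[cite: BodineauGallagherSaintRaymondInvent2016, §5.3.2 Prop. 5.5, pp. 19–20] -/
theorem abs_blockComp_sub_sepBlockComp_le_of_budget {δ : ℝ} (hδ : 0 ≤ δ) {A : ℕ} (hA : 2 ≤ A)
    {R C₀ β : ℝ} (hR : 0 ≤ R) (hC₀ : 1 ≤ C₀) (hβ : 0 < β) {G : GCState d X} (hGn : ∀ k, IsNice (G k))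
    (K : ℕ) (hG : IsLevelBdd G (pruneLevel A K) R C₀ β) {h : ℝ} (hh0 : 0 ≤ h) (Z : Config 1 d X) :
    |M.blockComp (pruneSeq A) h K G 1 Z - M.sepBlockComp δ (pruneSeq A) h K G 1 Z| ≤
      12 * R * C₀ * (C₀ * M.pruneConst β * δ) * (A : ℝ) ^ (2 * K) *
        exp (12 * (C₀ * M.pruneConst β * h) * (A : ℝ) ^ K) := by
  have hA1 : 1 ≤ A := by omega
  have hC₀0 : 0 ≤ C₀ := zero_le_one.trans hC₀
  have hcR := M.pruneConst_nonneg β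
  set βs : ℕ → ℝ := fun b => β / 4 / 2 ^ (K - b) with hβs
  have hβs0 : ∀ b, 0 < βs b := fun b => by positivity
  have hbudget : β / 2 + ∑ b ∈ Finset.range K, βs b ≤ β := by
    have hsum : ∑ b ∈ Finset.range K, βs b = β / 4 * ∑ b ∈ Finset.range K, (1 / 2 : ℝ) ^ (K - b) := by
      rw [Finset.mul_sum]
      refine Finset.sum_congr rfl fun b _ => ?_
      show β / 4 / 2 ^ (K - b) = β / 4 * (1 / 2) ^ (K - b)
      rw [one_div, inv_pow, div_eq_mul_inv]
    rw [hsum]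
    nlinarith [sum_half_pow_le K, hβ]
  have hmain := abs_blockComp_sub_sepBlockComp_le (M := M) hδ hA1 (half_pos hβ) hC₀ βs hβs0 hh0 K G R β
    hR hGn hbudget hG Z
  refine hmain.trans ?_
  have hP := M.prod_blockFactor_le hA hC₀ hβ hh0 K
  have hS := M.sum_sepError_le hδ hA hC₀ hβ hh0 K
  have hP0 : 0 ≤ ∏ b ∈ Finset.range K, ∑ j ∈ Finset.range (pruneSeq A b),
      (C₀ * M.chainCost (β / 2) (βs b / pruneSeq A b) (pruneLevel A (b + 1)) * h) ^ j / j ! :=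
    Finset.prod_nonneg fun b _ => Finset.sum_nonneg fun j _ => by
      have := M.chainCost_nonneg (β / 2) (βs b / pruneSeq A b) (pruneLevel A (b + 1)); positivity
  have hS0 : 0 ≤ ∑ b ∈ Finset.range K, ∑ j ∈ Finset.range (pruneSeq A b),
      2 * δ * j * ((C₀ * M.chainCost (β / 2) (βs b / pruneSeq A b) (pruneLevel A (b + 1))) ^ j *
        h ^ (j - 1) / (j - 1)!) :=
    Finset.sum_nonneg fun b _ => Finset.sum_nonneg fun j _ => by
      have := M.chainCost_nonneg (β / 2) (βs b / pruneSeq A b) (pruneLevel A (b + 1)); positivity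
  have hRC : 0 ≤ R * C₀ := mul_nonneg hR hC₀0
  calc R * C₀ * (∏ b ∈ Finset.range K, ∑ j ∈ Finset.range (pruneSeq A b),
          (C₀ * M.chainCost (β / 2) (βs b / pruneSeq A b) (pruneLevel A (b + 1)) * h) ^ j / j !) *
        ∑ b ∈ Finset.range K, ∑ j ∈ Finset.range (pruneSeq A b),
          2 * δ * j * ((C₀ * M.chainCost (β / 2) (βs b / pruneSeq A b) (pruneLevel A (b + 1))) ^ j *
            h ^ (j - 1) / (j - 1)!)
      ≤ R * C₀ * exp (6 * (C₀ * M.pruneConst β * h) * (A : ℝ) ^ K) *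
          (12 * δ * (C₀ * M.pruneConst β) * (A : ℝ) ^ (2 * K) * exp (6 * (C₀ * M.pruneConst β * h) * (A : ℝ) ^ K)) := by
        gcongr
    _ = 12 * R * C₀ * (C₀ * M.pruneConst β * δ) * (A : ℝ) ^ (2 * K) *
          exp (12 * (C₀ * M.pruneConst β * h) * (A : ℝ) ^ K) := by
        rw [show 12 * (C₀ * M.pruneConst β * h) * (A : ℝ) ^ K =
          6 * (C₀ * M.pruneConst β * h) * (A : ℝ) ^ K + 6 * (C₀ * M.pruneConst β * h) * (A : ℝ) ^ K by ring,
          Real.exp_add]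
        ring

end HierarchyModel

end Kinetic

end

end Literature.MathematicalPhysics.KineticTheory
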